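/-
Copyright: the b2b-balaban T⁴-continuum CRUX team, row NE7b OWNER lineage `t4-ne7b-p1` (gen 144). Project licence.
-/
import Summits.QuantumFields.BalabanUV.T4Continuum.Spine.NE7b.SupHessianVectorGeometryLetters
import Summits.QuantumFields.BalabanUV.T4Continuum.Spine.NE7b.SupFourthKernelTwoPointLetters

/-!
# THE THIRD-DERIVATIVE VECTOR'S GEOMETRY LETTERS (SCOPING (d15′)(vi); the `K4` analogue of (510) §1): for the third-derivative-entry
# observable `C_{xyz}` the Lipschitz vector is `c^{xyz}_w = Σ_u|A_{uw}|K4_{xyzu}`; for a factor of range `R` and a fourth majorant `K4` of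
# range `R₄` in its last slot, the weighted profile `Σ_w c^{xyz}_w e^{8μ d(p x, q w)}` is at most `e^{8μ(R+R₄)}·αr·k4e` (`k4e` the last-slot
# letter `Σ_uK4_{xyzu} ≤ k4e`) — (575)'s hypotheses `hkσ, hkσ′` for the finite-range factor, consumed by the next file (row NE7b, node U5c;
# (476) `weight_le_of_support`, (512) `third_vector_nonneg` BY NAME; [folklore])

Cell `pub-balaban`, sub-cell `t4`, spine estimate NE7b (`T4WeightBudget.RelWeightBound`; the cell's OWN estimate — NOT PRINTED in
[Bałaban 1983–89], NOT PROVED).  Crux-route work under `Spine/NE7b/` by the row OWNER (`t4-ne7b-p1` gen 144, file (602)) under FREEZE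
(0)'s crux-prover clause; NOTHING of Bałaban's is named as a Lean object, valued or asserted; no `T4Continuum/Support` leaf typed; no
`def`, no notation; zero `sorry`.  Imports (BY NAME): the OWNER's (510) `…SupHessianVectorGeometryLetters` ((476) through it), (512)
`…SupFourthKernelTwoPointLetters`.

WHAT IS PROVED ([folklore]): `third4_vector_rowsum_le`, `third4_support`, **`weighted_third4_rowsum_le`**, `weighted_third4_entry_le`; toy.

HONEST (what this is NOT).  Geometry bookkeeping only.  Scalar skeleton ((A3), NC-NE7b-α UNRULED); nothing of Bałaban's asserted.  BY-NAME
EFFECT ON THE WALL: NONE.  NE7b NOT PRINTED ∕ NOT PROVED; spine PROVED 0∕9; rung (B)+1 — the programme's measures remain FINITE-torus statements;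
NOT the mass gap, NOT Clay.  HONEST DEPENDENCY: continuum YM on T⁴ ⇐ BetaPertH ∧ nine spine estimates (0∕9 proved); BetaPertH ⇐ (D1) ∧ (D4) ∧
CAP+tail; G-an2-4 gates asym, D1 and NE2∕3∕4.
-/

set_option autoImplicit false

noncomputable section

namespace Summit.QuantumFields.BalabanUV.T4Continuum.NE7b.SupThirdDerivativeVectorGeometryLetters

open Finset Real Matrix
open scoped BigOperators
open SupFiniteRangeGeometryLetters (weight_le_of_support)
open SupFourthKernelTwoPointLetters (third_vector_nonneg)

variable {ι κ X : Type} [Fintype ι] [DecidableEq ι] [Fintype κ] [DecidableEq κ] [PseudoMetricSpace X]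

/-! ## §1. The third-derivative vector `c^{xyz}_w = Σ_u|A_{uw}|K4_{xyzu}`: plain and weighted profile letters (the `K4` analogue of (510)) -/

section Letters

variable {A : Matrix ι κ ℝ} {K4 : ι → ι → ι → ι → ℝ} {p : ι → X} {q : κ → X} {μ R R₄ αr k4e : ℝ}

omit [DecidableEq ι] [DecidableEq κ] [PseudoMetricSpace X] in
/-- **The plain mass**: `Σ_w c^{xyz}_w ≤ αr·k4e` (`Σ_w|A_{uw}| ≤ αr`, `Σ_uK4_{xyzu} ≤ k4e`, `K4 ≥ 0`). [folklore] -/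
theorem third4_vector_rowsum_le (hK40 : ∀ x y z u, 0 ≤ K4 x y z u) (hαr : ∀ u, ∑ w, |A u w| ≤ αr) (hk4e : ∀ x y z, ∑ u, K4 x y z u ≤ k4e)
    (x y z : ι) : ∑ w, ∑ u, |A u w| * K4 x y z u ≤ αr * k4e := by
  rcases isEmpty_or_nonempty ι with hι | ⟨⟨u₀⟩⟩
  · exact (hι.false x).elim
  have hαr0 : 0 ≤ αr := (Finset.sum_nonneg fun w _ => abs_nonneg (A u₀ w)).trans (hαr u₀)
  rw [Finset.sum_comm]
  calc ∑ u, ∑ w, |A u w| * K4 x y z u = ∑ u, (∑ w, |A u w|) * K4 x y z u := Finset.sum_congr rfl fun u _ => (Finset.sum_mul _ _ _).symm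
    _ ≤ ∑ u, αr * K4 x y z u := Finset.sum_le_sum fun u _ => mul_le_mul_of_nonneg_right (hαr u) (hK40 x y z u)
    _ = αr * ∑ u, K4 x y z u := (Finset.mul_sum _ _ _).symm
    _ ≤ αr * k4e := mul_le_mul_of_nonneg_left (hk4e x y z) hαr0

omit [Fintype ι] [DecidableEq ι] [Fintype κ] [DecidableEq κ] in
/-- **The support of the vector's terms**: if `|A_{uw}|·K4_{xyzu} ≠ 0` then `d(p x, q w) ≤ R + R₄` (factor of range `R`, majorant of range
`R₄` in its last slot). [folklore] -/
theorem third4_support (hAR : ∀ u w, A u w = 0 ∨ dist (p u) (q w) ≤ R) (hK4R : ∀ x y z u, K4 x y z u = 0 ∨ dist (p x) (p u) ≤ R₄)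
    (x y z u : ι) (w : κ) : |A u w| * K4 x y z u = 0 ∨ dist (p x) (q w) ≤ R + R₄ := by
  rcases hAR u w with h1 | h1
  · left; rw [h1, abs_zero, zero_mul]
  rcases hK4R x y z u with h3 | h3
  · left; rw [h3, mul_zero]
  right
  calc dist (p x) (q w) ≤ dist (p x) (p u) + dist (p u) (q w) := dist_triangle _ _ _
    _ ≤ R₄ + R := by gcongr
    _ = R + R₄ := by ring

omit [DecidableEq ι] [DecidableEq κ] in
/-- **THE WEIGHTED PROFILE LETTER OF THE THIRD-DERIVATIVE VECTOR** ((575)'s `hkσ`): `Σ_w c^{xyz}_w·e^{8μ·d(p x,q w)} ≤ e^{8μ(R+R₄)}·αr·k4e`.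
[folklore] -/
theorem weighted_third4_rowsum_le (hK40 : ∀ x y z u, 0 ≤ K4 x y z u) (hαr : ∀ u, ∑ w, |A u w| ≤ αr) (hk4e : ∀ x y z, ∑ u, K4 x y z u ≤ k4e)
    (hμ : 0 ≤ μ) (hAR : ∀ u w, A u w = 0 ∨ dist (p u) (q w) ≤ R) (hK4R : ∀ x y z u, K4 x y z u = 0 ∨ dist (p x) (p u) ≤ R₄) (x y z : ι) :
    ∑ w, (∑ u, |A u w| * K4 x y z u) * Real.exp (8 * μ * dist (p x) (q w)) ≤ Real.exp (8 * μ * (R + R₄)) * (αr * k4e) := by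
  have h8 : 0 ≤ 8 * μ := by linarith
  have hterm : ∀ w, (∑ u, |A u w| * K4 x y z u) * Real.exp (8 * μ * dist (p x) (q w)) ≤
      (∑ u, |A u w| * K4 x y z u) * Real.exp (8 * μ * (R + R₄)) := fun w => by
    rw [Finset.sum_mul, Finset.sum_mul]
    exact Finset.sum_le_sum fun u _ => weight_le_of_support (mul_nonneg (abs_nonneg _) (hK40 x y z u)) h8 (third4_support hAR hK4R x y z u w)
  refine (Finset.sum_le_sum fun w _ => hterm w).trans ?_
  rw [← Finset.sum_mul, mul_comm]
  exact mul_le_mul_of_nonneg_left (third4_vector_rowsum_le hK40 hαr hk4e x y z) (Real.exp_pos _).le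

omit [DecidableEq ι] [DecidableEq κ] in
/-- **THE WEIGHTED ENTRY LETTER** ((575)'s `hkσ'`): `c^{xyz}_w·e^{8μ·d(p x,q w)} ≤ e^{8μ(R+R₄)}·αr·k4e`. [folklore] -/
theorem weighted_third4_entry_le (hK40 : ∀ x y z u, 0 ≤ K4 x y z u) (hαr : ∀ u, ∑ w, |A u w| ≤ αr) (hk4e : ∀ x y z, ∑ u, K4 x y z u ≤ k4e)
    (hμ : 0 ≤ μ) (hAR : ∀ u w, A u w = 0 ∨ dist (p u) (q w) ≤ R) (hK4R : ∀ x y z u, K4 x y z u = 0 ∨ dist (p x) (p u) ≤ R₄) (x y z : ι)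
    (w : κ) : (∑ u, |A u w| * K4 x y z u) * Real.exp (8 * μ * dist (p x) (q w)) ≤ Real.exp (8 * μ * (R + R₄)) * (αr * k4e) := by
  refine le_trans ?_ (weighted_third4_rowsum_le hK40 hαr hk4e hμ hAR hK4R x y z)
  exact Finset.single_le_sum (f := fun w => (∑ u, |A u w| * K4 x y z u) * Real.exp (8 * μ * dist (p x) (q w)))
    (fun w _ => mul_nonneg (third_vector_nonneg hK40 A x y z w) (Real.exp_pos _).le) (Finset.mem_univ w)

end Letters

/-! ## §2. Toy -/

/-- Toy (the support mechanism in numbers): a weight at a point within range is at most the weight at the range. -/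
example (μ d D : ℝ) (hμ : 0 ≤ μ) (h : d ≤ D) : Real.exp (μ * d) ≤ Real.exp (μ * D) :=
  Real.exp_le_exp.2 (mul_le_mul_of_nonneg_left h hμ)

end Summit.QuantumFields.BalabanUV.T4Continuum.NE7b.SupThirdDerivativeVectorGeometryLetters

end
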